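import Mathlib
import HarnessLib
import Summits.HubbardSuperconductivity.HubbardSuperconductivity.Theorems.KLProgrammeKLRegimeTwoVolumeResummedReadout
import Summits.HubbardSuperconductivity.HubbardSuperconductivity.Theorems.KLProgrammeKLRegimeGridTwistedShift

/-!
# Route `KLProgramme` — ENGINE child `KLRegimeEngineV16` (stmt-HubbardSuperconductivity-20236), `stub_twoLeg_scale0`, conjunct
# (E3f-AT)₀, spatial nested leg `hsp`: the two-volume local part from the PINNED GRID DEFECT of the resummed quartic grid actions at an
# ARBITRARY fine pin — `hrep`, `hrow` and the block geometry discharged (cell gate-hubbard-kl, seat hubbard-kl-k3c5-p2 g6, β′ lane)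

`…TwoVolumeResummedReadout.abs_klLocalPart_sub_le_resummed` reads the two-volume difference of the local part `ν_n(K)(θ)` from grid
representations `W̃c`, `W̃f` of the purely quartic K-resummed theory under three kinds of hypotheses: (hrep) `map S W̃ = effAction C̃ V_U`,
(hrow) base-point independence of the phase-weighted two-leg rows, (geometry) a block embedding `ι` with the base point at the ORIGIN.
Here all three are discharged for THE grid actions `W̃_L := effAction (S_Lᵀ·normalCovariance p̃_L·S_L) (hubbardGridInteraction L N β U)`
(`S_L = hubbardGridSub L M β N`) at an ARBITRARY fine pin `w`:

* (geometry) the read-out is applied in coordinates CENTRED at the pin — coarse sites measured from `c̄ = (r₀, r₀)`, `r₀ = (Lc − 1)/2`, fine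
  sites from the pin's site — with the embedding `ι (j, x̄) = (j, site w + clift(x̄ − c̄))` onto the centred block around `w` (`hblock` for free);
  with k3c4-p1's `⌊x/m⌋`-blocks this block is the block of `w` exactly when `w`'s residue is `(r₀, r₀)` — the deepest pin;
* (hrep) the substitution with shifted coordinates is `S ∘ (leg shift)` (`toLin'_gridSubMatrix_shift`), the grid action is invariant under
  a purely spatial shift (`…GridTwistedShift.signedShift_gridEffAction` with all signs `+1`), and `map S W̃ = effAction C̃ (map S V_g) = effAction C̃ V_U`
  ([tree] `effAction_map`, `map_hubbardGridSub_gridInteraction`, `4M ≤ N + 1`);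
* (hrow) `…GridTwistedShift.gridEffAction_row_eq_row` (`2M ≤ N`), transported to the shifted coordinates.

Result **`abs_klLocalPart_sub_le_gridDefect_pin`**: for `0 < β`, nested `Lf = b·Lc`, `2M ≤ N`, `4M ≤ N + 1`, unit framed partition functions,
every scale `n`, every fine pin `w`, every `θ`,
`|klLocalPart Lc M … K n θ − klLocalPart Lf M … K n θ| ≤ 2·far|c_{Re E∘p_f}| + ‖τ̌_c‖₁·(2N/|β|)·Def_w(W̃c, W̃f) + 2·(2N/|β|)·(M₁(τ̌_f)·N₂ + ‖τ̌_f‖₁·M₂)/T`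
with `Def_w = Σ_{p₁} ‖W̃c(ō,p₁) − W̃f(w, ι p₁)‖ + Σ_{p₁' ∉ range ι} ‖W̃f(w,p₁')‖` (`ō = (time w, c̄)`), `N₂`, `M₂` the fine pinned profile / first moment
at `w` — the Grassmann side is now literally a PINNED TWO-LEG DEFECT of two explicit grid effective actions at one deep pin.

Proofs only; no definitions; nothing is asserted about bounds beyond the stated inequality.
-/

noncomputable section

namespace Summit.HubbardSuperconductivity.HubbardSuperconductivity.Theorems.TwoVolumeDefect

set_option linter.dupNamespace false -- summit = problem name (single-conjunct summit), D-0017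

open Finset Complex Literature.MathematicalPhysics.QuantumLattice Literature.Probability.LatticeModels GrassmannAlgebra
open Summit.HubbardSuperconductivity.HubbardSuperconductivity.Theorems.KLRegimeSplit
open Summit.HubbardSuperconductivity.HubbardSuperconductivity.Theorems.KLProgrammeLegKernels
open Summit.HubbardSuperconductivity.HubbardSuperconductivity.Theorems.TwoPointAssembly
open Summit.HubbardSuperconductivity.HubbardSuperconductivity.Theorems.TwoLegFourier
open scoped ComplexConjugate

/-! ## §1 The substitution with shifted coordinates is the substitution composed with a leg shift -/

section Shift

variable {L M N : ℕ} [NeZero L] [NeZero N]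

/-- **Shifted coordinates = substitution after a leg shift**: with `x p = (p − t).2`, `τ p = τ_{(p − t).1}`,
`map (toLin' (gridSubMatrix L M β x τ)) F = map (toLin' S) (F ∘ (· − t))`, `S = hubbardGridSub L M β N`. -/
theorem map_gridSubMatrix_shift (β : ℝ) (t : GridPoint L N) (F : GrassmannAlgebra ℂ (GridLeg (GridPoint L N))) :
    ExteriorAlgebra.map (Matrix.toLin' (gridSubMatrix L M β (fun p : GridPoint L N => (p - t).2) (fun p => gridTime β N (p - t).1))) F =
      ExteriorAlgebra.map (Matrix.toLin' (hubbardGridSub L M β N))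
        (ExteriorAlgebra.map (LinearMap.funLeft ℂ ℂ
          (Equiv.prodCongr (Equiv.prodCongr (Equiv.addRight (-t)) (Equiv.refl (Fin 2))) (Equiv.refl (Fin 2)) :
            GridLeg (GridPoint L N) ≃ GridLeg (GridPoint L N)).symm) F) := by
  set e : GridLeg (GridPoint L N) ≃ GridLeg (GridPoint L N) :=
    Equiv.prodCongr (Equiv.prodCongr (Equiv.addRight (-t)) (Equiv.refl (Fin 2))) (Equiv.refl (Fin 2)) with he
  have hlin : Matrix.toLin' (gridSubMatrix L M β (fun p : GridPoint L N => (p - t).2) (fun p => gridTime β N (p - t).1)) =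
      Matrix.toLin' (hubbardGridSub L M β N) ∘ₗ LinearMap.funLeft ℂ ℂ e.symm := by
    refine LinearMap.ext fun v => funext fun K => ?_
    simp only [LinearMap.comp_apply, Matrix.toLin'_apply, Matrix.mulVec, dotProduct, LinearMap.funLeft_apply]
    refine Finset.sum_equiv e (fun _ => by simp) (fun Y _ => ?_)
    have hY : e Y = ((Y.1.1 + -t, Y.1.2), Y.2) := rfl
    rw [Equiv.symm_apply_apply, hY, hubbardGridSub, gridSubMatrix_apply, gridSubMatrix_apply]
    simp only [sub_eq_add_neg]
  rw [hlin, ← ExteriorAlgebra.map_comp_map, AlgHom.comp_apply]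

/-- **A purely spatial shift leaves the grid effective action invariant** (all fermionic signs are `+1`). -/
theorem spatialShift_gridEffAction {β : ℝ} (hβ : β ≠ 0) (hN : 2 * M ≤ N) (p : FreqMomentum L M × Fin 2 → ℂ) (U : ℝ) (a : TorusSite 2 L) :
    ExteriorAlgebra.map (LinearMap.funLeft ℂ ℂ
        (Equiv.prodCongr (Equiv.prodCongr (Equiv.addRight (((0 : Fin N), a) : GridPoint L N)) (Equiv.refl (Fin 2))) (Equiv.refl (Fin 2)) :
          GridLeg (GridPoint L N) ≃ GridLeg (GridPoint L N)).symm)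
        (effAction ℂ ((hubbardGridSub L M β N).transpose * normalCovariance L M p * hubbardGridSub L M β N) (hubbardGridInteraction L N β U)) =
      effAction ℂ ((hubbardGridSub L M β N).transpose * normalCovariance L M p * hubbardGridSub L M β N) (hubbardGridInteraction L N β U) := by
  have h := signedShift_gridEffAction hβ hN p U (((0 : Fin N), a) : GridPoint L N)
  have hsgn : (fun Y : GridLeg (GridPoint L N) => if ((((0 : Fin N), a) : GridPoint L N)).1.val ≤ Y.1.1.1.val then (1 : ℂ) else -1) = 1 := by
    funext Y
    simp
  rw [hsgn, map_mulLeft_one] at h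
  exact h

/-- **(hrep) discharged**: with shifted coordinates the grid action represents the momentum-space action:
`map (toLin' (gridSubMatrix … (· − t).2 …)) W̃ = effAction (normalCovariance p) V_U` for `W̃ = effAction (Sᵀ·normalCovariance p·S) V_g`
(`t = (0, a)` spatial, `2M ≤ N`, `4M ≤ N + 1`, `β ≠ 0`). -/
theorem map_gridSubMatrix_shift_gridEffAction {β : ℝ} (hβ : β ≠ 0) (hN : 2 * M ≤ N) (hN4 : 4 * M ≤ N + 1) (p : FreqMomentum L M × Fin 2 → ℂ)
    (U : ℝ) (a : TorusSite 2 L) :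
    ExteriorAlgebra.map (Matrix.toLin' (gridSubMatrix L M β (fun q : GridPoint L N => (q - ((0 : Fin N), a)).2)
        (fun q => gridTime β N (q - ((0 : Fin N), a)).1)))
        (effAction ℂ ((hubbardGridSub L M β N).transpose * normalCovariance L M p * hubbardGridSub L M β N) (hubbardGridInteraction L N β U)) =
      effAction ℂ (normalCovariance L M p) (hubbardInteraction L M β U) := by
  rw [map_gridSubMatrix_shift, show -(((0 : Fin N), a) : GridPoint L N) = ((0 : Fin N), -a) by ext <;> simp,
    spatialShift_gridEffAction hβ hN p U (-a), ← map_hubbardGridSub_gridInteraction (L := L) (M := M) hβ U hN4, effAction_map,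
    LinearMap.toMatrix'_toLin']

/-- **(hrow) in shifted coordinates**: the phase-weighted two-leg rows of the grid action, written with `x q = (q − t).2`, `τ q = τ_{(q − t).1}`,
`t = (0, a)`, do not depend on the base point. -/
theorem gridEffAction_row_eq_row_shift {β : ℝ} (hβ : β ≠ 0) (hN : 2 * M ≤ N) (p : FreqMomentum L M × Fin 2 → ℂ) (U : ℝ) (a : TorusSite 2 L)
    (n : MatsubaraIdx M) (σ : Fin 2) (p₀ o : GridPoint L N) (y : TorusSite 2 L) :
    (∑ p₁ : GridPoint L N, if (p₁ - ((0 : Fin N), a)).2 = (p₀ - ((0 : Fin N), a)).2 + y then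
      Complex.exp (((matsubaraFreq β M n * (gridTime β N (p₀ - ((0 : Fin N), a)).1 - gridTime β N (p₁ - ((0 : Fin N), a)).1) : ℝ) : ℂ) * Complex.I) *
        kernel ℂ (effAction ℂ ((hubbardGridSub L M β N).transpose * normalCovariance L M p * hubbardGridSub L M β N)
          (hubbardGridInteraction L N β U)) 2 (fun i => ((![p₀, p₁] i, σ), i))
      else 0) =
    ∑ p₁ : GridPoint L N, if (p₁ - ((0 : Fin N), a)).2 = (o - ((0 : Fin N), a)).2 + y then
      Complex.exp (((matsubaraFreq β M n * (gridTime β N (o - ((0 : Fin N), a)).1 - gridTime β N (p₁ - ((0 : Fin N), a)).1) : ℝ) : ℂ) * Complex.I) *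
        kernel ℂ (effAction ℂ ((hubbardGridSub L M β N).transpose * normalCovariance L M p * hubbardGridSub L M β N)
          (hubbardGridInteraction L N β U)) 2 (fun i => ((![o, p₁] i, σ), i))
      else 0 := by
  have hcond : ∀ q q' : GridPoint L N, ((q - ((0 : Fin N), a)).2 = (q' - ((0 : Fin N), a)).2 + y) ↔ (q.2 = q'.2 + y) := by
    intro q q'
    simp only [Prod.snd_sub]
    constructor
    · intro h; have := congrArg (· + a) h; simp at this; rw [this]; abel
    · intro h; rw [h]; abel
  have htime : ∀ q : GridPoint L N, (q - ((0 : Fin N), a)).1 = q.1 := fun q => by simp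
  simp_rw [hcond, htime]
  exact gridEffAction_row_eq_row hβ hN p U n σ p₀ o y

end Shift

/-! ## §2 The centred block around a pin: the embedding `ι` and its properties -/

section Block

variable {b Lc Lf N : ℕ} [NeZero Lc] [NeZero Lf]

omit [NeZero Lc] [NeZero Lf] in
/-- **Every fine point whose offset from the pin is a centred lift lies in the centred block** (`hblock`). -/
theorem mem_range_blockEmb (wsite : TorusSite 2 Lf) (cbar : TorusSite 2 Lc) (p' : GridPoint Lf N)
    (h : Torus.proj Lf (Torus.cRep (fun i => ((((p'.2 - wsite) i).val : ℕ) : ZMod Lc))) = p'.2 - wsite) :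
    p' ∈ Set.range (fun p : GridPoint Lc N => ((p.1, wsite + Torus.proj Lf (Torus.cRep (p.2 - cbar))) : GridPoint Lf N)) := by
  refine ⟨(p'.1, cbar + fun i => ((((p'.2 - wsite) i).val : ℕ) : ZMod Lc)), ?_⟩
  ext1
  · rfl
  · show wsite + Torus.proj Lf (Torus.cRep ((cbar + fun i => ((((p'.2 - wsite) i).val : ℕ) : ZMod Lc)) - cbar)) = p'.2
    rw [add_sub_cancel_left, h, add_sub_cancel]

/-- The block embedding is injective. -/
theorem blockEmb_injective (hL : Lf = b * Lc) (wsite : TorusSite 2 Lf) (cbar : TorusSite 2 Lc) :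
    Function.Injective (fun p : GridPoint Lc N => ((p.1, wsite + Torus.proj Lf (Torus.cRep (p.2 - cbar))) : GridPoint Lf N)) := by
  intro p q h
  dsimp only at h
  obtain ⟨h1, h2⟩ := Prod.mk_inj.1 h
  have h3 : p.2 - cbar = q.2 - cbar := clift_injective hL (add_left_cancel h2)
  exact Prod.ext h1 (sub_left_injective h3)

end Block

/-! ## §3 The door: the two-volume local part from the pinned grid defect at an arbitrary fine pin -/

section Door

variable {b Lc Lf M N : ℕ} [NeZero Lc] [NeZero Lf] [NeZero M] [NeZero N]

omit [NeZero Lf] [NeZero M] [NeZero N] in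
/-- `|GridPoint L N| = N·L²`. -/
theorem card_gridPoint (L : ℕ) [NeZero L] : Fintype.card (GridPoint L N) = N * L ^ 2 := by
  simp [GridPoint, Fintype.card_prod, Fintype.card_fin, ZMod.card]

omit [NeZero Lc] [NeZero Lf] [NeZero M] [NeZero N] in
/-- `uvSymbolFn` is linear in its volume constant: `Ψ_c = c·Ψ_1`. -/
theorem uvSymbolFn_eq_mul_one (c Λ e ω : ℝ) : uvSymbolFn c Λ e ω = (c : ℂ) * uvSymbolFn 1 Λ e ω := by
  simp only [uvSymbolFn, resolventFn]
  push_cast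
  ring

omit [NeZero Lf] [NeZero M] [NeZero N] in
/-- The scale-`n` cutoff symbol at the string `((ω₀,k⃗),↑)` is `βL²` times the volume-free continuum symbol
`u(q) = uvSymbolFn 1 Λ (−2Σcos qᵢ − μ − K(q)) ω₀` sampled at `p_k⃗`. -/
theorem uvSymbolCT_eq_mul_sampled {β : ℝ} (hβ : 0 < β) (μ : ℝ) (K : TrigPolyC4v) (Λ : ℝ) (i : MatsubaraIdx M) (kv : TorusSite 2 Lc) (σ : Fin 2) :
    uvSymbolCT Lc M β μ K Λ ((i, kv), σ) = ((β * (Lc : ℝ) ^ 2 : ℝ) : ℂ) *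
      uvSymbolFn 1 Λ (-2 * (∑ l : Fin 2, Real.cos (latticeMomentum Lc kv l)) - μ - K.eval (latticeMomentum Lc kv)) (matsubaraFreq β M i) := by
  rw [uvSymbolCT_eq_uvSymbolFn hβ μ K Λ i kv σ, uvSymbolFn_eq_mul_one]
  simp only [nambuXiCT, torusBand]

/-- **THE DOOR AT A PIN.**  `0 < β`, nested volumes `Lf = b·Lc`, common Matsubara cutoff `M` and time grid `N` (`2M ≤ N`, `4M ≤ N + 1`), unit framed
partition functions at both volumes, any scale `n`, any fine pin `w`.  With `c̄ = (r₀,r₀)`, `r₀ = (Lc−1)/2`, `ō = (time w, c̄)`,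
`ι (j,x̄) = (j, site w + clift(x̄ − c̄))`, the resummed symbols `p̃_L = p_L/(1 + p_L κ_L)` and the grid actions
`W̃_L = effAction (S_Lᵀ·normalCovariance p̃_L·S_L) (hubbardGridInteraction L N β U)`:
`|klLocalPart Lc … n θ − klLocalPart Lf … n θ| ≤ 2·far|c_{Re E∘p_f}| + ‖τ̌_c‖₁·(2N/|β|)·Def_w + 2(2N/|β|)(M₁(τ̌_f)N₂ + ‖τ̌_f‖₁M₂)/T`. -/
theorem abs_klLocalPart_sub_le_gridDefect_pin (hL : Lf = b * Lc) {β : ℝ} (hβ : 0 < β) (hN : 2 * M ≤ N) (hN4 : 4 * M ≤ N + 1)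
    (U μ : ℝ) (K : TrigPolyC4v) (n : ℕ) (w : GridPoint Lf N)
    (hZc : IsUnit (effPartitionFn ℂ (normalCovariance Lc M (uvSymbolCT Lc M β μ K (klScale klE0 n)))
      (hubbardInteraction Lc M β U + counterQuadratic Lc M β K)))
    (hZf : IsUnit (effPartitionFn ℂ (normalCovariance Lf M (uvSymbolCT Lf M β μ K (klScale klE0 n)))
      (hubbardInteraction Lf M β U + counterQuadratic Lf M β K)))
    (θ : ℝ) :
    |klLocalPart Lc M β U μ K n θ - klLocalPart Lf M β U μ K n θ| ≤
      2 * (∑ y ∈ univ.filter (fun y : TorusSite 2 Lf => Torus.proj Lf (Torus.cRep (fun i => (((y i).val : ℕ) : ZMod Lc))) ≠ y),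
        |torusCosCoeff Lf (fun k => ((K.eval (latticeMomentum Lf k) : ℂ) -
          (K.eval (latticeMomentum Lf k) : ℂ) ^ 2 *
            (uvSymbolFn 1 (klScale klE0 n) (-2 * (∑ l : Fin 2, Real.cos (latticeMomentum Lf k l)) - μ - K.eval (latticeMomentum Lf k))
                (matsubaraFreq β M (omega0 M)) /
              (1 + uvSymbolFn 1 (klScale klE0 n) (-2 * (∑ l : Fin 2, Real.cos (latticeMomentum Lf k l)) - μ - K.eval (latticeMomentum Lf k))
                (matsubaraFreq β M (omega0 M)) * K.eval (latticeMomentum Lf k)))).re) y|) +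
      ((∑ z : TorusSite 2 Lc, ‖torusFourierInv (fun k => (1 - (K.eval (latticeMomentum Lc k) : ℂ) *
          (uvSymbolFn 1 (klScale klE0 n) (-2 * (∑ l : Fin 2, Real.cos (latticeMomentum Lc k l)) - μ - K.eval (latticeMomentum Lc k))
              (matsubaraFreq β M (omega0 M)) /
            (1 + uvSymbolFn 1 (klScale klE0 n) (-2 * (∑ l : Fin 2, Real.cos (latticeMomentum Lc k l)) - μ - K.eval (latticeMomentum Lc k))
              (matsubaraFreq β M (omega0 M)) * K.eval (latticeMomentum Lc k)))) ^ 2) z‖) * (2 * N / |β| *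
        ((∑ p₁ : GridPoint Lc N, ‖kernel ℂ (effAction ℂ ((hubbardGridSub Lc M β N).transpose *
              normalCovariance Lc M (fun ks => uvSymbolCT Lc M β μ K (klScale klE0 n) ks /
                (1 + uvSymbolCT Lc M β μ K (klScale klE0 n) ks * ((K.eval (latticeMomentum Lc ks.1.2) / (β * (Lc : ℝ) ^ 2) : ℝ) : ℂ))) *
              hubbardGridSub Lc M β N) (hubbardGridInteraction Lc N β U)) 2
              (fun i => ((![((w.1, fun _ : Fin 2 => (((Lc - 1) / 2 : ℕ) : ZMod Lc)) : GridPoint Lc N), p₁] i, 0), i)) -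
            kernel ℂ (effAction ℂ ((hubbardGridSub Lf M β N).transpose *
              normalCovariance Lf M (fun ks => uvSymbolCT Lf M β μ K (klScale klE0 n) ks /
                (1 + uvSymbolCT Lf M β μ K (klScale klE0 n) ks * ((K.eval (latticeMomentum Lf ks.1.2) / (β * (Lf : ℝ) ^ 2) : ℝ) : ℂ))) *
              hubbardGridSub Lf M β N) (hubbardGridInteraction Lf N β U)) 2
              (fun i => ((![w, ((p₁.1, w.2 + Torus.proj Lf (Torus.cRep (p₁.2 - fun _ : Fin 2 => (((Lc - 1) / 2 : ℕ) : ZMod Lc)))) : GridPoint Lf N)] i, 0), i))‖) +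
          ∑ p₁' ∈ univ.filter (fun p₁' : GridPoint Lf N => p₁' ∉ Set.range (fun p : GridPoint Lc N =>
              ((p.1, w.2 + Torus.proj Lf (Torus.cRep (p.2 - fun _ : Fin 2 => (((Lc - 1) / 2 : ℕ) : ZMod Lc)))) : GridPoint Lf N))),
            ‖kernel ℂ (effAction ℂ ((hubbardGridSub Lf M β N).transpose *
              normalCovariance Lf M (fun ks => uvSymbolCT Lf M β μ K (klScale klE0 n) ks /
                (1 + uvSymbolCT Lf M β μ K (klScale klE0 n) ks * ((K.eval (latticeMomentum Lf ks.1.2) / (β * (Lf : ℝ) ^ 2) : ℝ) : ℂ))) *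
              hubbardGridSub Lf M β N) (hubbardGridInteraction Lf N β U)) 2 (fun i => ((![w, p₁'] i, 0), i))‖)) +
      2 * (((∑ z : TorusSite 2 Lf, (Torus.tnorm z : ℝ) * ‖torusFourierInv (fun k => (1 - (K.eval (latticeMomentum Lf k) : ℂ) *
              (uvSymbolFn 1 (klScale klE0 n) (-2 * (∑ l : Fin 2, Real.cos (latticeMomentum Lf k l)) - μ - K.eval (latticeMomentum Lf k))
                  (matsubaraFreq β M (omega0 M)) /
                (1 + uvSymbolFn 1 (klScale klE0 n) (-2 * (∑ l : Fin 2, Real.cos (latticeMomentum Lf k l)) - μ - K.eval (latticeMomentum Lf k))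
                  (matsubaraFreq β M (omega0 M)) * K.eval (latticeMomentum Lf k)))) ^ 2) z‖) *
            (2 * N / |β| * ∑ p₁' : GridPoint Lf N, ‖kernel ℂ (effAction ℂ ((hubbardGridSub Lf M β N).transpose *
              normalCovariance Lf M (fun ks => uvSymbolCT Lf M β μ K (klScale klE0 n) ks /
                (1 + uvSymbolCT Lf M β μ K (klScale klE0 n) ks * ((K.eval (latticeMomentum Lf ks.1.2) / (β * (Lf : ℝ) ^ 2) : ℝ) : ℂ))) *
              hubbardGridSub Lf M β N) (hubbardGridInteraction Lf N β U)) 2 (fun i => ((![w, p₁'] i, 0), i))‖) +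
          (∑ z : TorusSite 2 Lf, ‖torusFourierInv (fun k => (1 - (K.eval (latticeMomentum Lf k) : ℂ) *
              (uvSymbolFn 1 (klScale klE0 n) (-2 * (∑ l : Fin 2, Real.cos (latticeMomentum Lf k l)) - μ - K.eval (latticeMomentum Lf k))
                  (matsubaraFreq β M (omega0 M)) /
                (1 + uvSymbolFn 1 (klScale klE0 n) (-2 * (∑ l : Fin 2, Real.cos (latticeMomentum Lf k l)) - μ - K.eval (latticeMomentum Lf k))
                  (matsubaraFreq β M (omega0 M)) * K.eval (latticeMomentum Lf k)))) ^ 2) z‖) *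
            (2 * N / |β| * ∑ p₁' : GridPoint Lf N, (Torus.tnorm (p₁'.2 - w.2) : ℝ) *
              ‖kernel ℂ (effAction ℂ ((hubbardGridSub Lf M β N).transpose *
                normalCovariance Lf M (fun ks => uvSymbolCT Lf M β μ K (klScale klE0 n) ks /
                  (1 + uvSymbolCT Lf M β μ K (klScale klE0 n) ks * ((K.eval (latticeMomentum Lf ks.1.2) / (β * (Lf : ℝ) ^ 2) : ℝ) : ℂ))) *
                hubbardGridSub Lf M β N) (hubbardGridInteraction Lf N β U)) 2 (fun i => ((![w, p₁'] i, 0), i))‖)) /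
        (((Lc - 1) / 2 + 1 : ℕ) : ℝ))) := by
  classical
  -- data of the centred coordinates
  set cbar : TorusSite 2 Lc := fun _ : Fin 2 => (((Lc - 1) / 2 : ℕ) : ZMod Lc) with hcbar
  set tc : GridPoint Lc N := ((0 : Fin N), cbar) with htc
  set tf : GridPoint Lf N := ((0 : Fin N), w.2) with htf
  set xg : GridPoint Lc N → TorusSite 2 Lc := fun q => (q - tc).2 with hxg
  set τg : GridPoint Lc N → ℝ := fun q => gridTime β N (q - tc).1 with hτg
  set xg' : GridPoint Lf N → TorusSite 2 Lf := fun q => (q - tf).2 with hxg'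
  set τg' : GridPoint Lf N → ℝ := fun q => gridTime β N (q - tf).1 with hτg'
  set o : GridPoint Lc N := (w.1, cbar) with ho
  set ι : GridPoint Lc N → GridPoint Lf N := fun q => (q.1, w.2 + Torus.proj Lf (Torus.cRep (q.2 - cbar))) with hι
  set u : (Fin 2 → ℝ) → ℂ := fun q => uvSymbolFn 1 (klScale klE0 n) (-2 * (∑ l : Fin 2, Real.cos (q l)) - μ - K.eval q) (matsubaraFreq β M (omega0 M))
    with hu
  set pc : FreqMomentum Lc M × Fin 2 → ℂ := fun ks => uvSymbolCT Lc M β μ K (klScale klE0 n) ks /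
    (1 + uvSymbolCT Lc M β μ K (klScale klE0 n) ks * ((K.eval (latticeMomentum Lc ks.1.2) / (β * (Lc : ℝ) ^ 2) : ℝ) : ℂ)) with hpc
  set pf : FreqMomentum Lf M × Fin 2 → ℂ := fun ks => uvSymbolCT Lf M β μ K (klScale klE0 n) ks /
    (1 + uvSymbolCT Lf M β μ K (klScale klE0 n) ks * ((K.eval (latticeMomentum Lf ks.1.2) / (β * (Lf : ℝ) ^ 2) : ℝ) : ℂ)) with hpf
  set Wc := effAction ℂ ((hubbardGridSub Lc M β N).transpose * normalCovariance Lc M pc * hubbardGridSub Lc M β N) (hubbardGridInteraction Lc N β U)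
    with hWc
  set Wf := effAction ℂ ((hubbardGridSub Lf M β N).transpose * normalCovariance Lf M pf * hubbardGridSub Lf M β N) (hubbardGridInteraction Lf N β U)
    with hWf
  -- geometry
  have hxo : xg o = 0 := by simp [hxg, ho, htc]
  have hιx : ∀ q, xg' (ι q) = Torus.proj Lf (Torus.cRep (xg q)) := by
    intro q; simp [hxg', hι, htf, hxg, htc]
  have hιτ : ∀ q, τg' (ι q) = τg q := by intro q; simp [hτg', hι, htf, hτg, htc]
  have hιinj : Function.Injective ι := blockEmb_injective (N := N) hL w.2 cbar
  have hblock : ∀ p' : GridPoint Lf N, Torus.proj Lf (Torus.cRep (fun i => (((xg' p' i).val : ℕ) : ZMod Lc))) = xg' p' → p' ∈ Set.range ι := by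
    intro p' hp'
    have hx : xg' p' = p'.2 - w.2 := by simp [hxg', htf]
    rw [hx] at hp'
    exact mem_range_blockEmb w.2 cbar p' hp'
  -- representations
  have hrepc : ExteriorAlgebra.map (Matrix.toLin' (gridSubMatrix Lc M β xg τg)) Wc = effAction ℂ (normalCovariance Lc M pc) (hubbardInteraction Lc M β U) :=
    map_gridSubMatrix_shift_gridEffAction hβ.ne' hN hN4 pc U cbar
  have hrepf : ExteriorAlgebra.map (Matrix.toLin' (gridSubMatrix Lf M β xg' τg')) Wf = effAction ℂ (normalCovariance Lf M pf) (hubbardInteraction Lf M β U) :=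
    map_gridSubMatrix_shift_gridEffAction hβ.ne' hN hN4 pf U w.2
  -- rows
  have hrowc := fun (p₀ : GridPoint Lc N) (y : TorusSite 2 Lc) => gridEffAction_row_eq_row_shift hβ.ne' hN pc U cbar (omega0 M) 0 p₀ o y
  have hrowf := fun (p₀' : GridPoint Lf N) (y : TorusSite 2 Lf) => gridEffAction_row_eq_row_shift hβ.ne' hN pf U w.2 (omega0 M) 0 p₀' (ι o) y
  -- the symbols
  have huc : ∀ kv : TorusSite 2 Lc, uvSymbolCT Lc M β μ K (klScale klE0 n) ((omega0 M, kv), 0) = ((β * (Lc : ℝ) ^ 2 : ℝ) : ℂ) * u (latticeMomentum Lc kv) :=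
    fun kv => uvSymbolCT_eq_mul_sampled hβ μ K (klScale klE0 n) (omega0 M) kv 0
  have huf : ∀ kv : TorusSite 2 Lf, uvSymbolCT Lf M β μ K (klScale klE0 n) ((omega0 M, kv), 0) = ((β * (Lf : ℝ) ^ 2 : ℝ) : ℂ) * u (latticeMomentum Lf kv) :=
    fun kv => uvSymbolCT_eq_mul_sampled hβ μ K (klScale klE0 n) (omega0 M) kv 0
  -- the pin coincides with `ι o`
  have hιo : ι o = w := by
    simp only [hι, ho, sub_self]
    ext1
    · rfl
    · show w.2 + Torus.proj Lf (Torus.cRep (0 : TorusSite 2 Lc)) = w.2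
      rw [clift_zero, add_zero]
  have key := abs_klLocalPart_sub_le_resummed hL hβ U μ K n xg τg xg' τg' (card_gridPoint Lc) (card_gridPoint Lf) ι hιinj hιx hιτ hblock hxo u
    huc huf Wc Wf hrepc hrepf hZc hZf hrowc hrowf θ
  rw [hιo] at key
  have hx' : ∀ p₁' : GridPoint Lf N, xg' p₁' = p₁'.2 - w.2 := fun p₁' => by simp [hxg', htf]
  simp only [hx'] at key
  exact key

end Door

end Summit.HubbardSuperconductivity.HubbardSuperconductivity.Theorems.TwoVolumeDefect

end
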